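import Mathlib
import HarnessLib
import Literature.Analysis.FluidPDE.SuitableWeak
import Literature.Analysis.FluidPDE.TypeIAncientMild
import Summits.NavierStokesRegularity.NavierStokesRegularity.Theorems.TypeIQuarterGateScarZoomDefs

/-!
# Route `TypeIQuarterGate` — objects posited by LINE `slice_budget` of crux `ScarEnvelopeTypeI`
  (item stmt-NavierStokesRegularity-23843): singular points, the slice-wise octave budget, the ESS
  normalisation, the ESS class at a point, the tame twin-scar object

Definitions ONLY — the five propositions / maps of the line file
`Cruxes/ScarEnvelopeTypeI/Lines/slice_budget.lean` (line owner ns-idea-7 g2, version 4, tree timestamp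
2026-08-28T07:20:24Z, critic idea-crit-7 PASS-WITH-PRICE 2026-08-28T06:13:26Z, «the better of the two
23843 lines»), copied VERBATIM (with the line's local notation `E3` spelled out as
`EuclideanSpace ℝ (Fin 3)`) into an importable module in the line's own namespace
`…Cruxes.ScarEnvelopeTypeI.SliceBudget`, so that the line's registered stubs

* `stub_sliceOctaveBudget : CruxHypotheses ν T u p → TameOutside T u → OctaveBudget ν T u` (SD, deciding),
* `stub_tameScarZoom      : CruxHypotheses ν T u p → OctaveBudget ν T u → ScarViolators T u →
                              ∃ M v, TameTwinScar M v` (SB)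

can be proved in separate `Theorems/` files against ONE tree declaration each and the skeleton can
import them by name (precedent on the same crux: `TypeIQuarterGateScarZoomDefs`, p606736, whose
`CruxHypotheses`, `TameOutside`, `ScarViolators`, `SingularAt` these definitions build on).

* `SingularPt T u a` — `a` is a scar of `u` at time `T`: `u` is unbounded on every small backward
  parabolic neighbourhood `(T − r², T) × B_r(a)`, `r² ≤ T`;
* `OctaveBudget ν T u` — the SLICE-WISE OCTAVE (e-ANNULUS) BUDGET at the scars: at every singular point
  `a` there are `q, δ, r₀` with `∫_{ℓ<|y−a|<eℓ} |u(t)|³ ≤ q` for all `t ∈ (T−δ, T)` and all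
  parabolically admissible radii `√(ν(T−t)) ≤ ℓ ≤ r₀` (implied by the crux's envelope; the line's
  deciding stub SD asserts it under the crux hypotheses);
* `essTranslate v e` — the ESS normalisation `w(s,y) = ½ v(s/4, e + y/2)` (Navier–Stokes scaling
  `λ = 1/2` composed with the translation by `e`), mapping the unit backward cylinder of `w` onto
  `(−1/4, 0) × B(e, 1/2)`;
* `ESSClassAt v e` — the normalised translate satisfies on the unit backward cylinder exactly the
  hypotheses of Escauriaza–Seregin–Šverák 2003 Thm 1.4 as proved in the tree
  (`Literature.Analysis.FluidPDE.ess_local_holder_holds`): distributional Navier–Stokes with a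
  pressure, `L^∞_t L²_x`, a weak spatial gradient in `L²`, pressure in `L^{3/2}`, `L^∞_t L³_x`;
* `TameTwinScar M v` — a Type-I ancient mild solution (`IsTypeIAncientMild M v`) singular at time `0`
  at the origin AND at a point `e` of the unit sphere at which it lies in the ESS class (the line
  proves in its skeleton that no such object exists, by ESS Thm 1.4).

HONEST FRAMING: nothing is asserted here (definitions only); the crux `ScarEnvelopeTypeI`, its parent
`QuarterLawTypeI` and the summit are OPEN; no statement about them is proved by this file.
-/

noncomputable section

-- the summit-side namespace `Summit.NavierStokesRegularity.NavierStokesRegularity.…` (single-conjunct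
-- summit, D-0017) repeats a component by design; the dupNamespace linter would flag every declaration.
set_option linter.dupNamespace false

namespace Summit.NavierStokesRegularity.NavierStokesRegularity.Cruxes.ScarEnvelopeTypeI.SliceBudget

open MeasureTheory
open Summit.NavierStokesRegularity.NavierStokesRegularity.Cruxes.ScarEnvelopeTypeI.ScarZoom (SingularAt)

/-- `a` is a SINGULAR POINT (scar) of the solution `u` at time `T`: `u` is unbounded on every small
backward parabolic neighbourhood `(T − r², T) × B_r(a)` with `r² ≤ T`.  Verbatim from the line file
`Cruxes/ScarEnvelopeTypeI/Lines/slice_budget.lean`. -/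
def SingularPt (T : ℝ) (u : ℝ → EuclideanSpace ℝ (Fin 3) → EuclideanSpace ℝ (Fin 3))
    (a : EuclideanSpace ℝ (Fin 3)) : Prop :=
  ∀ r : ℝ, 0 < r → r ^ 2 ≤ T → ∀ A : ℝ,
    ∃ t ∈ Set.Ioo (T - r ^ 2) T, ∃ y ∈ Metric.ball a r, A < ‖u t y‖

/-- THE SLICE-WISE OCTAVE (e-ANNULUS) BUDGET at the scars: at every singular point `a` there are
`q, δ, r₀` such that at every time `t ∈ (T−δ, T)` every e-annulus `ℓ < |x−a| < eℓ` at a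
parabolically admissible position `√(ν(T−t)) ≤ ℓ ≤ r₀` carries cube `∫|u(t)|³ ≤ q`.  Implied by
`Envelope` under the crux hypotheses (the profile `C'/(|y−a|+ℓ)` deposits `≤ 4πC'³` per
e-annulus; scars are finitely many and separated, so `r₀ <` a third of their mutual distance keeps
the other scars out; `SingularPt ⊆ σ`), hence WEAKER than the crux's conclusion.  Verbatim from the
line file. -/
def OctaveBudget (ν T : ℝ) (u : ℝ → EuclideanSpace ℝ (Fin 3) → EuclideanSpace ℝ (Fin 3)) : Prop :=
  ∀ a : EuclideanSpace ℝ (Fin 3), SingularPt T u a → ∃ q δ r₀ : ℝ, 0 < δ ∧ 0 < r₀ ∧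
    ∀ t ∈ Set.Ioo (T - δ) T, ∀ ℓ : ℝ, Real.sqrt (ν * (T - t)) ≤ ℓ → ℓ ≤ r₀ →
      ∫⁻ y in {y : EuclideanSpace ℝ (Fin 3) | ℓ < ‖y - a‖ ∧ ‖y - a‖ < Real.exp 1 * ℓ},
          ‖u t y‖ₑ ^ (3 : ℝ)
        ≤ ENNReal.ofReal q

/-- The ESS-normalised translate of `v` at `e`: `w(s,y) = ½ v(s/4, e + y/2)`, which maps the unit
backward cylinder `Q₁(0,0)` of `w` onto the cylinder `(−1/4, 0) × B(e, 1/2)` of `v` (Navier–Stokes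
scaling `λ = 1/2` composed with the translation by `e`).  Verbatim from the line file. -/
def essTranslate (v : ℝ → EuclideanSpace ℝ (Fin 3) → EuclideanSpace ℝ (Fin 3))
    (e : EuclideanSpace ℝ (Fin 3)) : ℝ → EuclideanSpace ℝ (Fin 3) → EuclideanSpace ℝ (Fin 3) :=
  fun s y => (1 / 2 : ℝ) • v (s / 4) (e + (1 / 2 : ℝ) • y)

/-- THE ESS CLASS AT `e`: the normalised translate `w = essTranslate v e` satisfies, on the unit
backward cylinder, exactly the hypotheses of ESS 2003 Thm 1.4 as vendored in
`Literature.Analysis.FluidPDE.ess_local_holder`: distributional Navier–Stokes with some pressure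
`π`, `L^∞_t L²_x`, a weak spatial gradient in `L²`, `π ∈ L^{3/2}`, and `w ∈ L^∞_t L³_x(Q₁)` — the
last clause being what the annular budget around the origin delivers at a second scar.  Verbatim from
the line file. -/
def ESSClassAt (v : ℝ → EuclideanSpace ℝ (Fin 3) → EuclideanSpace ℝ (Fin 3))
    (e : EuclideanSpace ℝ (Fin 3)) : Prop :=
  ∃ π : ℝ → EuclideanSpace ℝ (Fin 3) → ℝ,
    Literature.Analysis.FluidPDE.IsDistributionalNSSolutionOn
        (Literature.Analysis.FluidPDE.parabolicCylinderOpens 1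
          ((0 : ℝ), (0 : EuclideanSpace ℝ (Fin 3)))) 1 0
        (essTranslate v e) π ∧
    (∃ C : NNReal, ∀ᵐ t ∂(volume.restrict (Set.Ioo (-1 : ℝ) 0)),
      ∫⁻ x in Metric.ball (0 : EuclideanSpace ℝ (Fin 3)) 1, ‖essTranslate v e t x‖ₑ ^ 2 ≤ C) ∧
    (∃ G : ℝ → EuclideanSpace ℝ (Fin 3) →
        EuclideanSpace ℝ (Fin 3) →L[ℝ] EuclideanSpace ℝ (Fin 3),
      Literature.Analysis.FluidPDE.HasWeakSpatialGradientOn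
          (Literature.Analysis.FluidPDE.parabolicCylinderOpens 1
            ((0 : ℝ), (0 : EuclideanSpace ℝ (Fin 3))))
          (essTranslate v e) G ∧
        ∫⁻ z in Literature.Analysis.FluidPDE.parabolicCylinder 1
            ((0 : ℝ), (0 : EuclideanSpace ℝ (Fin 3))),
          ENNReal.ofReal (Literature.Analysis.FluidPDE.frobeniusNormSq (G z.1 z.2)) < ⊤) ∧
    (∫⁻ z in Literature.Analysis.FluidPDE.parabolicCylinder 1
          ((0 : ℝ), (0 : EuclideanSpace ℝ (Fin 3))),
        ‖π z.1 z.2‖ₑ ^ (3 / 2 : ℝ) < ⊤) ∧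
    (∃ C : NNReal, ∀ᵐ t ∂(volume.restrict (Set.Ioo (-1 : ℝ) 0)),
      ∫⁻ x in Metric.ball (0 : EuclideanSpace ℝ (Fin 3)) 1, ‖essTranslate v e t x‖ₑ ^ 3 ≤ C)

/-- A TAME TWIN-SCAR OBJECT with Type-I constant `M`: a Type-I ancient mild solution in the
KNSS/Oseen gauge (`IsTypeIAncientMild M v`: jointly smooth on the open past, divergence free,
Oseen-mild, `‖v(t,x)‖ ≤ M/√(−t)`), singular at time `0` at the origin AND at a point `e` of the unit
sphere at which it lies in the ESS class (`SingularAt` is the landed `ScarZoom.SingularAt`, p606736,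
exactly as in the line file, which opens it by name).  Verbatim from the line file. -/
def TameTwinScar (M : ℝ) (v : ℝ → EuclideanSpace ℝ (Fin 3) → EuclideanSpace ℝ (Fin 3)) : Prop :=
  Literature.Analysis.FluidPDE.IsTypeIAncientMild M v ∧ SingularAt v 0 ∧
    ∃ e : EuclideanSpace ℝ (Fin 3), ‖e‖ = 1 ∧ SingularAt v e ∧ ESSClassAt v e

end Summit.NavierStokesRegularity.NavierStokesRegularity.Cruxes.ScarEnvelopeTypeI.SliceBudget

end
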